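import Summits.BirchSwinnertonDyer.Rank1Residual.Additive.X4RankZeroCoveredLocus
import Summits.BirchSwinnertonDyer.Rank1Residual.Additive.X4RankZeroTamagawaParity
import Summits.BirchSwinnertonDyer.Rank1Residual.Additive.X4SharpThreeAssembly
import HarnessLib

/-!
# X4 ∧ `r_an = 0`: the TAMAGAWA-DEFECT-ONE rows CLOSE BY PARITY AT EVERY ODD PRIME — `p = 3`
# included — Kato 2004 Thm. 14.5 (3) sharp + Cassels–Tate squareness
# (cell `b2b-bsdres`, seat additive-p4, line V23; `p ≥ 5` precedent: harvest-2's `X4RankZeroTamagawaParity.lean`)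

HONEST FRAMING (cell `b2b-bsdres`, run/shared/lean/b2b/bsd-rank1-residual/, verbatim in every
file): the goal of the cell is to DELETE the COMBINATION-SHAPED residual classes of the
Birch–Swinnerton-Dyer formula for ALL analytic-rank `≤ 1` elliptic curves over `ℚ` — "full BSD
formula for every rank `≤ 1` curve in class `C`" assembled STRICTLY from published theorems — so
that the rank-`≤ 1` remainder becomes exactly the CONSTRUCTION-SHAPED classes, which are TYPED
(missing-input `Prop`s), NOT attempted. This is not "finishing BSD". Sub-cell additive-p4 (X3♯/X4♯
direct): research route on the CONSTRUCTION-SHAPED class X4; no claim beyond the stated classes;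
the label X4 is UNCHANGED by this file; nothing is booked. Theorems only (no definition, no named
fact minted; every published input is an explicit named-fact hypothesis of the tree).

## What this file proves

On a potentially good X4 pair `(E, p)` of analytic rank `0` with `ρ̄_{E,p^n}` onto for all `n` and a
modular parametrisation datum of Manin constant prime to `p`, the SHARP Kato reading (Kato 2004
Thm. 14.5 (3) + Prop. 14.16 (2) with Kim 2026 §3.2.3; tree fact A161
`Kato2004.rankZero_padicValNat_sha_le_sub_localTamagawa_…`, `hKatoS`) gives
`ord_p #Ш(E) ≤ ord_p #Ш_an(E) + ord_p ∏ c_ℓ − v_p(c_p)` (`X4RankZeroKatoBoundSharp`). The rows with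
`ord_p ∏ c_ℓ > v_p(c_p)` — a Tamagawa number `c_ℓ`, `ℓ ≠ p`, divisible by `p` — were the TAM-DEFECT
residue of X4♯(unit-free) (`X4SharpUnitFreeResidue`; RESIDUAL-MAP §I N11 "Tamagawa-defect rows
137 ‖ 30 / 18 750" at `p = 3`): there `BSD(E,p)` needs `Ш(E)[p] = 0` and the Euler-system bound only
gives `ord_p #Ш ≤ ord_p ∏_{ℓ≠p} c_ℓ` (the equality is Kim's Conjecture 1.10). Harvest-2 (GEN 6,
`X4RankZeroTamagawaParity.lean`) observed at `p ≥ 5`, with KIM's bound, that Cassels' theorem — `#Ш`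
is a perfect SQUARE once finite (`hCT` = `WeierstrassCurve.exists_casselsTate_pairing`, bsd.S18;
`isSquare_shaOrder_of_casselsTate`) — closes the sub-population `ord_p ∏ c_ℓ = 1`: an even number
`≤ 1` is `0`. Kim's theorem is printed for `p ≥ 5` only. THIS FILE runs the same parity argument on
the KATO reading, which holds at every odd `p`, so that **the `p = 3` Tamagawa-defect-one rows close**:

* §1 `X4RankZero.even_padicValNat_shaOrder_and_le_of_katoSharp` — `ord_p #Ш` is EVEN and
  `≤ ord_p #Ш_an + ord_p ∏ c_ℓ − v_p(c_p)` (pot-good, tower, Manin; every odd `p`);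
  `X4RankZero.padicValNat_shaOrder_le_pred_of_katoSharp_of_casselsTate_of_odd` — when the
  right-hand side is ODD the bound improves by one.
* §2 **`X4RankZero.bsdp_of_katoSharp_of_casselsTate_of_tamDefect_le_one`** — X4 ∧ `r_an = 0` ∧
  `ord_p j ≥ 0` ∧ tower ∧ Manin datum ∧ **`ord_p ∏ c_ℓ ≤ v_p(c_p) + 1`** ∧ `p ∤ #Ш_an` ⟹ `BSD(E,p)`
  (every odd `p`); the typed upper half on the `#Ш_an = p^{2k}·unit` rows of the same shape
  (`X4RankZero.missingUpperBoundAt_of_katoSharp_of_casselsTate_of_tamDefect_le_one_of_even`).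
* §3 census shapes: **`X4RankZero.bsdp_three_of_cert_of_tamDefect_le_one_of_casselsTate`** (`p = 3`:
  tower fed by a `j`-witness / (ram) / surj(9) certificate, `towerSurj_three_of_surj_of_jWitness_or_nine`)
  and `X4RankZero.bsdp_of_casselsTate_of_tamDefect_le_one_of_five_le` (`p ≥ 5`: tower by Serre,
  `v_p(c_p) = 0` by Kodaira–Néron, so the binder is `p² ∤ ∏ c_ℓ` — harvest-2's row re-derived from
  the Kato reading, Kim 2026 not needed).
* §4 the covered locus of `X4RankZeroCoveredLocus` ENLARGED by parity
  (`X4RankZero.bsdp_of_facts_of_casselsTate_of_shaAn_unit`: certificate triple with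
  `ord_p ∏ c_ℓ ≤ v_p(c_p) + 1` in place of `=`).

Census (seat, `V23-*`; numbers of record in HOME/b2b-bsdres-additive-p4/, not in this docstring):
of the 136 ‖ 30 window (N < 2·10⁴ ‖ 10⁴) / 18 416 S-b sweep (N < 5·10⁵) Tamagawa-defect unit rows of
X4 ∧ `p = 3` ∧ `r_an = 0` (all potentially good, tower-certified, Cremona-optimal with `c = 1`;
harvest-2's three-engine `c₃` column), **127 ‖ 29 / 16 383 have `ord₃ ∏_{ℓ≠3} c_ℓ = 1` and CLOSE
here**; residue 9 ‖ 1 / 2 033 (`ord₃ ∏_{ℓ≠3} c_ℓ ≥ 2`: `ord₃ #Ш ∈ {0, 2}` …). X4 stays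
CONSTRUCTION-SHAPED; nothing booked.

References: Kato 2004 [Kato2004Asterisque] Thm. 14.5 (3), Prop. 14.16 (2), (12.5.2); Kim 2026
[Kim2022StructureSelmer] §3.2.3, Conj. 1.10; Cassels 1962 / Silverman *AEC* Thm. X.4.14
[SilvermanAEC2009]; Miller 2011 [Miller2011LMS] Def. 1.1; Serre 1972 [Serre1972] IV §3.4;
Silverman *ATAEC* Cor. IV.9.2 (d) [SilvermanATAEC1994]; RESIDUAL-MAP §I N11.
-/

noncomputable section

open scoped Classical

open WeierstrassCurve Literature.NumberTheory.EllipticCurves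
  Literature.NumberTheory.EllipticCurves.ModularForms
  Literature.NumberTheory.EllipticCurves.Rank1Residual
  Literature.NumberTheory.EllipticCurves.Rank1Residual.Typed

namespace Summit.BirchSwinnertonDyer.Rank1Residual.Additive

/-- Parity bookkeeping: an EVEN natural number bounded by an ODD integer is bounded by its
predecessor. [folklore] -/
theorem Nat.cast_le_sub_one_of_even_of_odd {n : ℕ} {B : ℤ} (hn : Even n) (hB : Odd B)
    (hle : (n : ℤ) ≤ B) : (n : ℤ) ≤ B - 1 := by
  rcases hle.lt_or_eq with hlt | heq
  · omega
  · exfalso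
    obtain ⟨k, hk⟩ := hn
    obtain ⟨m, hm⟩ := hB
    omega

variable (W : WeierstrassCurve ℚ) [W.IsElliptic] [W.IsGloballyMinimal] (p : ℕ) [hp : Fact p.Prime]

/-! ### §1 The sharp Kato bound with Cassels–Tate parity, every odd `p` -/

/-- **X4 ∧ `r_an = 0` ∧ `ord_p j ≥ 0` ∧ tower ∧ Manin datum, every odd `p`: `ord_p #Ш(E)` is EVEN and
`≤ ord_p #Ш_an + ord_p ∏ c_ℓ − v_p(c_p)`** — the inequality is the sharp Kato reading
(`X4RankZero.padicValNat_shaOrder_le_of_katoSharp`, fact `hKatoS`), evenness is Cassels' theorem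
(`hCT`: `#Ш` is a perfect square once `Ш` is finite — Gross–Zagier–Kolyvagin `hGZK`).
[cite: Kato2004Asterisque, Thm. 14.5 (3) (p. 236), Prop. 14.16 (2) (p. 244)]
[cite: SilvermanAEC2009, Thm. X.4.14] [cite: Kim2022StructureSelmer, §3.2.3 display before Thm. 3.7 (PDF p. 16)] -/
theorem X4RankZero.even_padicValNat_shaOrder_and_le_of_katoSharp
    (hCT : exists_casselsTate_pairing (K := ℚ))
    (hKatoS : Kato2004.rankZero_padicValNat_sha_le_sub_localTamagawa_of_additive_potGood_of_imageContainsSL2)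
    (hGZK : rank_eq_analyticRank_of_analyticRank_le_one) (hmod : hasEntireLFunction_rat)
    (hr : W.analyticRank = 0) (hX : ClassX4 W p) (hpot : 0 ≤ padicValRat p W.j)
    (htower : ∀ n : ℕ, W.HasSurjectiveModNGaloisRep (p ^ n : ℕ))
    {N : ℕ} [NeZero N] (D : ModularParametrizationData W N) (hc : ¬ (p : ℤ) ∣ D.maninConstant) :
    Even (padicValNat p W.shaOrder) ∧ ∃ q : ℚ, shaAn W = (q : ℂ) ∧
      (padicValNat p W.shaOrder : ℤ) ≤
        padicValRat p q + padicValNat p W.tamagawaProduct -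
          padicValNat p ((W.baseChange ℚ_[p]).localTamagawaNumber ℤ_[p]) := by
  have hfin : W.ShaFinite := (hGZK W (by rw [hr]; exact zero_le_one)).2
  refine ⟨?_, X4RankZero.padicValNat_shaOrder_le_of_katoSharp W p hKatoS hGZK hmod hr hX hpot htower D hc⟩
  obtain ⟨r, hr2⟩ := isSquare_shaOrder_of_casselsTate hCT W hfin
  have hn : W.shaOrder ≠ 0 := (WeierstrassCurve.shaOrder_pos W hfin).ne'
  have hr0 : r ≠ 0 := fun h ↦ hn (by simp [hr2, h])
  rw [hr2, padicValNat.mul hr0 hr0]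
  exact ⟨_, rfl⟩

/-- **Parity improvement**: under the same hypotheses, if `#Ш_an = q` and the sharp bound
`B = ord_p q + ord_p ∏ c_ℓ − v_p(c_p)` is dominated by an ODD integer `B'`, then
`ord_p #Ш ≤ B' − 1`. [cite: Kato2004Asterisque, Thm. 14.5 (3) (p. 236)] [cite: SilvermanAEC2009, Thm. X.4.14] -/
theorem X4RankZero.padicValNat_shaOrder_le_pred_of_katoSharp_of_casselsTate_of_odd
    (hCT : exists_casselsTate_pairing (K := ℚ))
    (hKatoS : Kato2004.rankZero_padicValNat_sha_le_sub_localTamagawa_of_additive_potGood_of_imageContainsSL2)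
    (hGZK : rank_eq_analyticRank_of_analyticRank_le_one) (hmod : hasEntireLFunction_rat)
    (hr : W.analyticRank = 0) (hX : ClassX4 W p) (hpot : 0 ≤ padicValRat p W.j)
    (htower : ∀ n : ℕ, W.HasSurjectiveModNGaloisRep (p ^ n : ℕ))
    {N : ℕ} [NeZero N] (D : ModularParametrizationData W N) (hc : ¬ (p : ℤ) ∣ D.maninConstant)
    {q : ℚ} (hq : shaAn W = (q : ℂ)) {B' : ℤ} (hodd : Odd B')
    (hB : padicValRat p q + padicValNat p W.tamagawaProduct -
      padicValNat p ((W.baseChange ℚ_[p]).localTamagawaNumber ℤ_[p]) ≤ B') :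
    (padicValNat p W.shaOrder : ℤ) ≤ B' - 1 := by
  obtain ⟨heven, q', hq', hle⟩ :=
    X4RankZero.even_padicValNat_shaOrder_and_le_of_katoSharp W p hCT hKatoS hGZK hmod hr hX hpot
      htower D hc
  have hqq : q' = q := by exact_mod_cast hq'.symm.trans hq
  subst hqq
  exact Nat.cast_le_sub_one_of_even_of_odd heven hodd (hle.trans hB)

/-! ### §2 The Tamagawa-defect-ONE rows close, every odd `p` -/

/-- **PARITY CLOSURE at every odd `p` — `p = 3` included.** X4 ∧ `r_an = 0` ∧ `ord_p j ≥ 0` ∧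
`ρ̄_{E,p^n}` onto ∀ `n` ∧ a datum `D` with `p ∤ c_D` ∧ **`ord_p ∏ c_ℓ ≤ v_p(c_p) + 1`** (at most ONE
factor `p` among the `c_ℓ`, `ℓ ≠ p`) ∧ `#Ш_an(E) = q` a `p`-unit ⟹ `BSD(E,p)`: the sharp Kato bound
reads `ord_p #Ш ≤ 1`, Cassels' theorem makes `ord_p #Ш` even, so `Ш(E)[p^∞] = 0` and
`ord_p #Ш = 0 = ord_p #Ш_an` (`Typed.bsdp_of_missingPPartAt`). PUBLISHED inputs only (Kato 2004
Thm. 14.5 (3) sharp `hKatoS`, Cassels–Tate `hCT`, GZK `hGZK`, modularity `hmod`) + per pair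
[`r_an = 0`, pot-good, tower, Manin datum, `ord_p ∏ c_ℓ ≤ v_p(c_p)+1`, `p ∤ #Ш_an`]. At `p = 3` these
are the RESIDUAL-MAP §I N11 "Tamagawa-defect rows" with a single `3` in `∏_{ℓ≠3} c_ℓ`.
[cite: Kato2004Asterisque, Thm. 14.5 (3) (p. 236), Prop. 14.16 (2) (p. 244)]
[cite: SilvermanAEC2009, Thm. X.4.14] [cite: Miller2011LMS, §1 and Def. 1.1] -/
theorem X4RankZero.bsdp_of_katoSharp_of_casselsTate_of_tamDefect_le_one
    (hCT : exists_casselsTate_pairing (K := ℚ))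
    (hKatoS : Kato2004.rankZero_padicValNat_sha_le_sub_localTamagawa_of_additive_potGood_of_imageContainsSL2)
    (hGZK : rank_eq_analyticRank_of_analyticRank_le_one) (hmod : hasEntireLFunction_rat)
    (hr : W.analyticRank = 0) (hX : ClassX4 W p) (hpot : 0 ≤ padicValRat p W.j)
    (htower : ∀ n : ℕ, W.HasSurjectiveModNGaloisRep (p ^ n : ℕ))
    {N : ℕ} [NeZero N] (D : ModularParametrizationData W N) (hc : ¬ (p : ℤ) ∣ D.maninConstant)
    (htam : padicValNat p W.tamagawaProduct ≤
      padicValNat p ((W.baseChange ℚ_[p]).localTamagawaNumber ℤ_[p]) + 1)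
    {q : ℚ} (hq : shaAn W = (q : ℂ)) (hv : padicValRat p q = 0) : BSDp W p := by
  have hfin : W.ShaFinite := (hGZK W (by rw [hr]; exact zero_le_one)).2
  have hsq : IsSquare W.shaOrder := isSquare_shaOrder_of_casselsTate hCT W hfin
  have hn : W.shaOrder ≠ 0 := (WeierstrassCurve.shaOrder_pos W hfin).ne'
  obtain ⟨-, q', hq', hle⟩ :=
    X4RankZero.even_padicValNat_shaOrder_and_le_of_katoSharp W p hCT hKatoS hGZK hmod hr hX hpot
      htower D hc
  have hqq : q' = q := by exact_mod_cast hq'.symm.trans hq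
  subst hqq
  rw [hv, zero_add] at hle
  have hle1 : padicValNat p W.shaOrder ≤ 1 := by
    have htam' : (padicValNat p W.tamagawaProduct : ℤ) ≤
        padicValNat p ((W.baseChange ℚ_[p]).localTamagawaNumber ℤ_[p]) + 1 := by exact_mod_cast htam
    have : (padicValNat p W.shaOrder : ℤ) ≤ 1 := by linarith
    exact_mod_cast this
  have h0 : padicValNat p W.shaOrder = 0 := padicValNat_eq_zero_of_isSquare_of_le_one hsq hn hle1
  exact bsdp_of_missingPPartAt W p hGZK (by rw [hr]; exact zero_le_one)
    ⟨q', hq', by rw [hv, h0, Nat.cast_zero]⟩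

/-- **The typed UPPER half on the Tamagawa-defect-one rows with `ord_p #Ш_an` EVEN** (e.g.
`#Ш_an = p²·unit`): X4 ∧ `r_an = 0` ∧ `ord_p j ≥ 0` ∧ tower ∧ Manin datum ∧
`ord_p ∏ c_ℓ ≤ v_p(c_p) + 1` ∧ `#Ш_an = q` with `ord_p q` even ⟹ `MissingUpperBoundAt W p`
(`ord_p #Ш ≤ ord_p q`): the sharp bound is `≤ ord_p q + 1`, odd, and parity removes the `+ 1`. So on
these rows only the LOWER half remains. [cite: Kato2004Asterisque, Thm. 14.5 (3) (p. 236)]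
[cite: SilvermanAEC2009, Thm. X.4.14] [cite: Miller2011LMS, Def. 1.1] -/
theorem X4RankZero.missingUpperBoundAt_of_katoSharp_of_casselsTate_of_tamDefect_le_one_of_even
    (hCT : exists_casselsTate_pairing (K := ℚ))
    (hKatoS : Kato2004.rankZero_padicValNat_sha_le_sub_localTamagawa_of_additive_potGood_of_imageContainsSL2)
    (hGZK : rank_eq_analyticRank_of_analyticRank_le_one) (hmod : hasEntireLFunction_rat)
    (hr : W.analyticRank = 0) (hX : ClassX4 W p) (hpot : 0 ≤ padicValRat p W.j)
    (htower : ∀ n : ℕ, W.HasSurjectiveModNGaloisRep (p ^ n : ℕ))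
    {N : ℕ} [NeZero N] (D : ModularParametrizationData W N) (hc : ¬ (p : ℤ) ∣ D.maninConstant)
    (htam : padicValNat p W.tamagawaProduct ≤
      padicValNat p ((W.baseChange ℚ_[p]).localTamagawaNumber ℤ_[p]) + 1)
    {q : ℚ} (hq : shaAn W = (q : ℂ)) (heven : Even (padicValRat p q)) :
    MissingUpperBoundAt W p := by
  obtain ⟨hevenSha, q', hq', hle⟩ :=
    X4RankZero.even_padicValNat_shaOrder_and_le_of_katoSharp W p hCT hKatoS hGZK hmod hr hX hpot
      htower D hc
  have hqq : q' = q := by exact_mod_cast hq'.symm.trans hq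
  subst hqq
  refine ⟨q', hq', ?_⟩
  have htam' : (padicValNat p W.tamagawaProduct : ℤ) ≤
      padicValNat p ((W.baseChange ℚ_[p]).localTamagawaNumber ℤ_[p]) + 1 := by exact_mod_cast htam
  have hB : (padicValNat p W.shaOrder : ℤ) ≤ padicValRat p q' + 1 := by linarith
  have hodd : Odd (padicValRat p q' + 1) := heven.add_one
  have := Nat.cast_le_sub_one_of_even_of_odd hevenSha hodd hB
  linarith

/-! ### §3 Census shapes: `p = 3` with a tower certificate, `p ≥ 5` with none -/

/-- **`p = 3` census shape — the N11 Tamagawa-defect-one rows close.** X4 ∧ `r_an = 0` ∧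
`ord₃ j ≥ 0` ∧ surj(3) ∧ [a `j`-WITNESS (prime `q ≠ 3`, `ord_q j < 0`, `3 ∤ ord_q j`; (ram) is the
multiplicative case) ∨ surj(9)] ∧ a datum `D` with `3 ∤ c_D` ∧ `ord₃ ∏ c_ℓ ≤ v₃(c₃) + 1` ∧
`3 ∤ #Ш_an` ⟹ `BSD(E,3)` — tower by `towerSurj_three_of_surj_of_jWitness_or_nine`
(`GaloisImage/JWitnessTowerSurjectivity`, lit-kato's mod-9 lift), then §2.
[cite: Kato2004Asterisque, Thm. 14.5 (3) (p. 236), (12.5.2) (p. 222)] [cite: SilvermanAEC2009, Thm. X.4.14]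
[cite: Miller2011LMS, §1 and Def. 1.1] -/
theorem X4RankZero.bsdp_three_of_cert_of_tamDefect_le_one_of_casselsTate
    (hCT : exists_casselsTate_pairing (K := ℚ))
    (hKatoS : Kato2004.rankZero_padicValNat_sha_le_sub_localTamagawa_of_additive_potGood_of_imageContainsSL2)
    (hGZK : rank_eq_analyticRank_of_analyticRank_le_one) (hmod : hasEntireLFunction_rat)
    (hr : W.analyticRank = 0) (hX : ClassX4 W 3) (hpot : 0 ≤ padicValRat 3 W.j) (hsurj : Surj W 3)
    (hcert : (∃ q : ℕ, q.Prime ∧ q ≠ 3 ∧ padicValRat q W.j < 0 ∧ ¬ (3 : ℤ) ∣ padicValRat q W.j) ∨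
      W.HasSurjectiveModNGaloisRep 9)
    {N : ℕ} [NeZero N] (D : ModularParametrizationData W N) (hc : ¬ (3 : ℤ) ∣ D.maninConstant)
    (htam : padicValNat 3 W.tamagawaProduct ≤
      padicValNat 3 ((WeierstrassCurve.baseChange W ℚ_[3]).localTamagawaNumber ℤ_[3]) + 1)
    {q : ℚ} (hq : shaAn W = (q : ℂ)) (hv : padicValRat 3 q = 0) : BSDp W 3 :=
  X4RankZero.bsdp_of_katoSharp_of_casselsTate_of_tamDefect_le_one W 3 hCT hKatoS hGZK hmod hr hX hpot
    (towerSurj_three_of_surj_of_jWitness_or_nine W hsurj hcert) D (by exact_mod_cast hc) htam hq hv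

/-- **`p ≥ 5` census shape — harvest-2's parity row from the KATO reading** (Kim 2026 not needed):
X4 ∧ `r_an = 0` ∧ `ord_p j ≥ 0` ∧ surj(p) ∧ a datum `D` with `p ∤ c_D` ∧ `p² ∤ ∏ c_ℓ` ∧ `p ∤ #Ш_an`
⟹ `BSD(E,p)`; tower by Serre, `v_p(c_p) = 0` by Kodaira–Néron (`X4RankZeroCoveredLocus` §0).
Compare `X4RankZero.bsdp_of_casselsTate_of_not_sq_dvd_tamagawaProduct` (Kim's bound, any additive
type). [cite: Kato2004Asterisque, Thm. 14.5 (3) (p. 236)] [cite: SilvermanAEC2009, Thm. X.4.14]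
[cite: Serre1972, IV §3.4] [cite: SilvermanATAEC1994, Cor. IV.9.2 (d) (PDF p. 340)] [cite: Miller2011LMS, §1 and Def. 1.1] -/
theorem X4RankZero.bsdp_of_casselsTate_of_tamDefect_le_one_of_five_le
    (hCT : exists_casselsTate_pairing (K := ℚ))
    (hKatoS : Kato2004.rankZero_padicValNat_sha_le_sub_localTamagawa_of_additive_potGood_of_imageContainsSL2)
    (hGZK : rank_eq_analyticRank_of_analyticRank_le_one) (hmod : hasEntireLFunction_rat)
    (hp5 : 5 ≤ p) (hr : W.analyticRank = 0) (hX : ClassX4 W p) (hpot : 0 ≤ padicValRat p W.j)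
    (hsurj : Surj W p)
    {N : ℕ} [NeZero N] (D : ModularParametrizationData W N) (hc : ¬ (p : ℤ) ∣ D.maninConstant)
    (htam : ¬ p ^ 2 ∣ W.tamagawaProduct)
    {q : ℚ} (hq : shaAn W = (q : ℂ)) (hv : padicValRat p q = 0) : BSDp W p :=
  X4RankZero.bsdp_of_katoSharp_of_casselsTate_of_tamDefect_le_one W p hCT hKatoS hGZK hmod hr hX hpot
    (serre_hasSurjectiveModNGaloisRep_pow_holds W p hp5 hsurj) D hc
    (by
      rw [padicValNat_localTamagawaNumber_padic_eq_zero_of_addv W p hX.2.1 hp5, zero_add]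
      exact padicValNat_le_one_of_not_sq_dvd (W.tamagawaProduct_pos_holds).ne' htam) hq hv

/-! ### §4 The covered locus enlarged by parity -/

/-- **THE CHAIN OF RECORD FOR X4 ∧ `r = 0` AT EVERY ODD `p`, PARITY FORM**: X4 ∧ `r_an = 0` ∧
surj(p) ∧ [`ord_p j < 0` ∨ (`ρ̄_{E,p^n}` onto ∀ `n` ∧ **`ord_p ∏ c_ℓ ≤ v_p(c_p) + 1`** ∧ Manin datum)]
∧ `p ∤ #Ш_an` ⟹ `BSD(E,p)` — `X4RankZero.bsdp_of_facts_of_shaAn_unit` with the Tamagawa bit of the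
certificate triple relaxed from `=` to `≤ · + 1` by Cassels–Tate. Six named facts (sharp Kato
`hKatoS`; Delbourgo Prop. 4 `hDel`; `hmodD`; Wuthrich L. 20 `hL20`; Kato half-eigen `hKatoχ`;
Cassels–Tate `hCT`) + GZK + modularity. [cite: Kato2004Asterisque, Thm. 14.5 (3) (p. 236), Thm. 17.4 (3) (p. 273)]
[cite: Delbourgo1998, Prop. 4 (p. 144)] [cite: Wuthrich2014, Lemma 20 (p. 399), Cor. 19 (p. 398)]
[cite: SilvermanAEC2009, Thm. X.4.14] [cite: Miller2011LMS, §1 and Def. 1.1] -/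
theorem X4RankZero.bsdp_of_facts_of_casselsTate_of_shaAn_unit
    (hCT : exists_casselsTate_pairing (K := ℚ))
    (hKatoS : Kato2004.rankZero_padicValNat_sha_le_sub_localTamagawa_of_additive_potGood_of_imageContainsSL2)
    (hDel : Delbourgo1998.prop4_rankZero_pow_dvd_constantCoeff)
    (hGZK : rank_eq_analyticRank_of_analyticRank_le_one) (hmod : hasEntireLFunction_rat)
    (hmodD : nonempty_modularParametrizationData)
    (hL20 : Wuthrich2014.lemma20_surjective_threeAdic_of_semistable)
    (hKatoχ : Wuthrich2014.kato_halfEigenCharIdeal_dvd_cyclotomicPrime_of_surjective)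
    (hr : W.analyticRank = 0) (hX : ClassX4 W p) (hsurj : Surj W p)
    (hcov : padicValRat p W.j < 0 ∨
      ((∀ n : ℕ, W.HasSurjectiveModNGaloisRep (p ^ n : ℕ)) ∧
        padicValNat p W.tamagawaProduct ≤
          padicValNat p ((W.baseChange ℚ_[p]).localTamagawaNumber ℤ_[p]) + 1 ∧
        ∃ (N : ℕ) (_ : NeZero N) (D : ModularParametrizationData W N), ¬ (p : ℤ) ∣ D.maninConstant))
    {q : ℚ} (hq : shaAn W = (q : ℂ)) (hv : padicValRat p q = 0) : BSDp W p := by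
  by_cases hj : padicValRat p W.j < 0
  · exact X4RankZero.bsdp_of_facts_of_shaAn_unit W p hKatoS hDel hGZK hmod hmodD hL20 hKatoχ hr hX
      hsurj (Or.inl hj) hq hv
  · obtain ⟨htower, htam, N, hN, D, hc⟩ := hcov.resolve_left hj
    haveI := hN
    exact X4RankZero.bsdp_of_katoSharp_of_casselsTate_of_tamDefect_le_one W p hCT hKatoS hGZK hmod hr
      hX (not_lt.mp hj) htower D hc htam hq hv

end Summit.BirchSwinnertonDyer.Rank1Residual.Additive

end
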